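import Mathlib.Analysis.Calculus.FDeriv.Equiv
import Mathlib.Analysis.Normed.Group.Ultra
import Mathlib.Topology.MetricSpace.Ultra.Basic
import Mathlib.Analysis.SpecificLimits.Basic
import HarnessLib

/-!
# Ultrametric Newton charts: a strictly differentiable map with invertible derivative is, on every small enough box,
# «its linearisation up to one level» (the filtered Newton hypothesis)

Topic `Analysis/Calculus`, namespace `Literature.Analysis.Calculus`.  THEOREMS ONLY (no definition ∕ instance ∕ notation ∕ named fact).

SETTING.  `𝕜` a non-trivially normed field, `V` an ULTRAMETRIC normed `𝕜`-space (`IsUltrametricDist V`: e.g. `Fⁿ`, `Mₙ(F)`, any subspace, for a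
non-archimedean local field `F` with its valuation norm `Valued.toNormedField`), `W` any normed `𝕜`-space, `φ : V → W` with a STRICT derivative
`HasStrictFDerivAt φ e x₀` that is a continuous linear equivalence `e : V ≃L[𝕜] W`.  The BOX FILTRATION of ratio `γ ∈ (0,1)` and size `r > 0` is the
decreasing sequence of closed balls `B_j := closedBall 0 (r·γʲ)` — in an ultrametric group these are open additive subgroups (Mathlib
`IsUltrametricDist.closedBall_openAddSubgroup`), compact when `V` is proper, and a basis of neighbourhoods of `0`.

MAIN RESULT (§2) `exists_depth_linearNewton_of_hasStrictFDerivAt`: there is a depth `k₀` such that for all `k ≥ k₀`, all `j ≥ k`, all `x ∈ B_k`, `y ∈ B_j`,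
  `φ (x₀ + (x + y)) − φ (x₀ + x) − e y ∈ e '' B_{j+1}`,
i.e. the translated chart `v ↦ φ (x₀ + v) − φ x₀` satisfies the FILTERED NEWTON HYPOTHESIS WITH LINEAR PART `e` at every depth `k ≥ k₀` (the hypothesis `(N_L)` under
which the standard «Newton∕Hensel» coset calculus gives: injectivity on the box, `φ '' (x + B_j) = φ x + e '' B_j` coset for coset, and preservation of Haar
measure up to the modulus of `e`).  The proof is three lines of ultrametric bookkeeping on the little-`o` estimate `‖φ p − φ q − e (p − q)‖ ≤ γ·‖e‖⁻¹…`: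
strictness gives `‖ψ p − ψ q − (p − q)‖ ≤ γ‖p − q‖` for `ψ := e⁻¹ ∘ φ` and `p, q` `δ`-close to `x₀`; with `‖x‖, ‖y‖ ≤ r γᵏ < δ` (ultrametric: `‖x + y‖ ≤ max`)
this is `‖ψ (x₀+x+y) − ψ (x₀+x) − y‖ ≤ γ · r γʲ = r γ^{j+1}`.
* §0 (any filtered abelian topological group, no norms) `continuousOn_of_newton` ∕ `continuousOn_of_linearNewton`: the Newton hypothesis alone makes the map
  continuous on the base box (so consumers of the coset calculus need not prove continuity separately).
* §1 box filtrations: `exists_addSubgroup_coe_eq_closedBall` (the balls `B_j` as `ℕ → AddSubgroup V`), and for any such `Λ`: `antitone_`, `isOpen_`,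
  `exists_subset_of_mem_nhds_` (neighbourhood basis), `isCompact_of_coe_eq_closedBall` (`[ProperSpace V]`).
* §2 the main result, in the identity-derivative form `exists_depth_newton_of_hasStrictFDerivAt_id`, the general form, and the `AddSubgroup`-phrased form
  `exists_depth_linearNewton_addSubgroup` (token shape of the filtered-Newton consumers: `∀ j, k ≤ j → ∀ x ∈ Λ k, ∀ y ∈ Λ j, φ₀ (x + y) − φ₀ x − L y ∈ L '' Λ (j+1)`
  with `φ₀ v := φ (x₀ + v) − φ x₀`, `L := e.toContinuousAddEquiv`).
Why strict (not merely Fréchet) differentiability: over a non-archimedean field a function with a continuous derivative need not be locally injective where the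
derivative is invertible; strict differentiability is exactly what the coset calculus needs [Schikhof1984, §27 (local invertibility of `C¹`∕strictly
differentiable maps), Thm. 27.5; §76], and every locally analytic map (convergent power series: polynomial maps, `X ↦ (1 − X)⁻¹`, Cayley transforms) is strictly
differentiable (Mathlib `HasFPowerSeriesAt.hasStrictFDerivAt`).  Not here: the coset calculus itself and its Haar-measure form (they live with their consumers),
and any statement about specific charts.

## References
* [Schikhof1984] W. H. Schikhof, *Ultrametric Calculus*, Cambridge Stud. Adv. Math. 4 (1984): §27 (strict differentiability, local invertibility, Thm. 27.5), §76.
* [Serre1992LALG] J.-P. Serre, *Lie Algebras and Lie Groups*, LNM 1500 (1992), Part II Ch. IV §9 (standard groups: filtrations by balls and maps that are the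
  identity up to one level).
-/

set_option autoImplicit false

open Filter Metric Set Asymptotics
open scoped Topology Pointwise

namespace Literature.Analysis.Calculus

/-! ## §0 The Newton hypothesis forces continuity on the base box (filtered abelian groups, no norms) -/

section Filtered

variable {V W : Type*} [AddCommGroup V] [TopologicalSpace V] [IsTopologicalAddGroup V]
  [AddCommGroup W] [TopologicalSpace W]
  (Λ : ℕ → AddSubgroup V) {k : ℕ}

/-- **Continuity from the Newton hypothesis.**  If `Λ` is a decreasing filtration by open subgroups forming a basis of neighbourhoods of `0`, and `ψ : V → V`
satisfies the filtered Newton hypothesis at depth `k` — `ψ (x + y) − ψ x − y ∈ Λ (j+1)` for `x ∈ Λ k`, `y ∈ Λ j`, `j ≥ k` — then `ψ` is continuous on the base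
box `Λ k` (indeed `ψ (x + Λ j) ⊆ ψ x + Λ j`). [cite: Serre1992LALG, Part II Ch. IV §9] -/
theorem continuousOn_of_newton (ψ : V → V) (hanti : Antitone Λ) (hopen : ∀ j, IsOpen (Λ j : Set V))
    (hbasis : ∀ U ∈ 𝓝 (0 : V), ∃ j, (Λ j : Set V) ⊆ U)
    (hN : ∀ j, k ≤ j → ∀ x ∈ Λ k, ∀ y ∈ Λ j, ψ (x + y) - ψ x - y ∈ Λ (j + 1)) :
    ContinuousOn ψ (Λ k : Set V) := by
  intro x hx
  rw [ContinuousWithinAt, _root_.tendsto_nhds]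
  -- it suffices to treat neighbourhoods of `ψ x`
  intro U hUo hxU
  -- pull `U` back to a neighbourhood of `0` along `w ↦ ψ x + w`
  have hcont : Continuous fun w : V => ψ x + w := continuous_const.add continuous_id
  have hU0 : (fun w : V => ψ x + w) ⁻¹' U ∈ 𝓝 (0 : V) :=
    hcont.continuousAt.preimage_mem_nhds (by simpa using hUo.mem_nhds hxU)
  obtain ⟨j₀, hj₀⟩ := hbasis _ hU0
  set j := max j₀ k with hjdef
  have hjk : k ≤ j := le_max_right _ _
  have hjj₀ : Λ j ≤ Λ j₀ := hanti (le_max_left _ _)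
  -- the neighbourhood `x + Λ j` of `x` within `Λ k` is mapped into `U`
  have hmem : (Λ k : Set V) ∩ (x +ᵥ (Λ j : Set V)) ∈ 𝓝[(Λ k : Set V)] x := by
    apply inter_mem_nhdsWithin
    have hox : IsOpen (x +ᵥ (Λ j : Set V)) := (hopen j).vadd x
    exact hox.mem_nhds ⟨0, (Λ j).zero_mem, by simp⟩
  refine mem_of_superset hmem ?_
  rintro x' ⟨-, ⟨y, hy, rfl⟩⟩
  have hy' : y ∈ Λ j := hy
  have hstep := hN j hjk x hx y hy'
  -- `ψ (x + y) = ψ x + ((ψ (x+y) - ψ x - y) + y)` with the bracket in `Λ j`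
  have hin : ψ (x + y) - ψ x ∈ Λ j := by
    have : ψ (x + y) - ψ x = (ψ (x + y) - ψ x - y) + y := by abel
    rw [this]
    exact (Λ j).add_mem (hanti (Nat.le_succ j) hstep) hy'
  have : ψ (x +ᵥ y) = ψ x + (ψ (x + y) - ψ x) := by simp [vadd_eq_add]
  show ψ (x +ᵥ y) ∈ U
  rw [this]
  exact hj₀ (hjj₀ hin)

/-- **Continuity from the Newton hypothesis, linear-part form**: if `φ : V → W` satisfies `φ (x + y) − φ x − L y ∈ L '' Λ (j+1)` (`x ∈ Λ k`, `y ∈ Λ j`, `j ≥ k`)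
for a topological additive isomorphism `L : V ≃ₜ+ W`, then `φ` is continuous on `Λ k`. [cite: Serre1992LALG, Part II Ch. IV §9] -/
theorem continuousOn_of_linearNewton (φ : V → W) (L : V ≃ₜ+ W) (hanti : Antitone Λ) (hopen : ∀ j, IsOpen (Λ j : Set V))
    (hbasis : ∀ U ∈ 𝓝 (0 : V), ∃ j, (Λ j : Set V) ⊆ U)
    (hN : ∀ j, k ≤ j → ∀ x ∈ Λ k, ∀ y ∈ Λ j, φ (x + y) - φ x - L y ∈ (L : V → W) '' (Λ (j + 1) : Set V)) :
    ContinuousOn φ (Λ k : Set V) := by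
  have hψ : ∀ j, k ≤ j → ∀ x ∈ Λ k, ∀ y ∈ Λ j, (L.symm ∘ φ) (x + y) - (L.symm ∘ φ) x - y ∈ Λ (j + 1) := by
    intro j hj x hx y hy
    obtain ⟨z, hz, hzeq⟩ := hN j hj x hx y hy
    have : (L.symm ∘ φ) (x + y) - (L.symm ∘ φ) x - y = L.symm (φ (x + y) - φ x - L y) := by
      simp [map_sub]
    rw [this, ← hzeq]
    simpa using hz
  have hc := continuousOn_of_newton Λ (L.symm ∘ φ) hanti hopen hbasis hψ
  have : φ = (L : V → W) ∘ (L.symm ∘ φ) := by ext v; simp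
  rw [this]
  exact L.continuous.comp_continuousOn hc

end Filtered

/-! ## §1 Box filtrations by closed balls in an ultrametric normed group -/

section Balls

variable (V : Type*) [SeminormedAddCommGroup V] [IsUltrametricDist V]

/-- **The balls `closedBall 0 (r γʲ)` as a sequence of additive subgroups** (ultrametric: closed balls around `0` of positive radius are open subgroups).
[cite: Serre1992LALG, Part II Ch. IV §9] -/
theorem exists_addSubgroup_coe_eq_closedBall {r γ : ℝ} (hr : 0 < r) (hγ : 0 < γ) :
    ∃ Λ : ℕ → AddSubgroup V, ∀ j, (Λ j : Set V) = closedBall (0 : V) (r * γ ^ j) :=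
  ⟨fun j => (IsUltrametricDist.closedBall_openAddSubgroup V (mul_pos hr (pow_pos hγ j))).toAddSubgroup, fun _ => rfl⟩

variable {V}
variable {Λ : ℕ → AddSubgroup V} {r γ : ℝ}

omit [IsUltrametricDist V] in
/-- A ball filtration is decreasing (`0 ≤ r`, `0 ≤ γ ≤ 1`). [cite: Serre1992LALG, Part II Ch. IV §9] -/
theorem antitone_of_coe_eq_closedBall (hΛ : ∀ j, (Λ j : Set V) = closedBall (0 : V) (r * γ ^ j)) (hr : 0 ≤ r) (hγ0 : 0 ≤ γ) (hγ1 : γ ≤ 1) :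
    Antitone Λ := by
  refine antitone_nat_of_succ_le fun j => ?_
  intro v hv
  have hv' : v ∈ (Λ (j + 1) : Set V) := hv
  rw [hΛ] at hv'
  show v ∈ (Λ j : Set V)
  rw [hΛ]
  exact closedBall_subset_closedBall (mul_le_mul_of_nonneg_left (pow_le_pow_of_le_one hγ0 hγ1 (Nat.le_succ j)) hr) hv'

/-- The members of a ball filtration are open (`r, γ > 0`). [cite: Serre1992LALG, Part II Ch. IV §9] -/
theorem isOpen_of_coe_eq_closedBall (hΛ : ∀ j, (Λ j : Set V) = closedBall (0 : V) (r * γ ^ j)) (hr : 0 < r) (hγ0 : 0 < γ) (j : ℕ) :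
    IsOpen (Λ j : Set V) := by
  rw [hΛ]
  exact IsUltrametricDist.isOpen_closedBall _ (mul_pos hr (pow_pos hγ0 j)).ne'

omit [IsUltrametricDist V] in
/-- A ball filtration of ratio `γ < 1` is a basis of neighbourhoods of `0`. [cite: Serre1992LALG, Part II Ch. IV §9] -/
theorem exists_subset_of_mem_nhds_of_coe_eq_closedBall (hΛ : ∀ j, (Λ j : Set V) = closedBall (0 : V) (r * γ ^ j)) (hr : 0 < r)
    (hγ1 : γ < 1) : ∀ U ∈ 𝓝 (0 : V), ∃ j, (Λ j : Set V) ⊆ U := by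
  intro U hU
  obtain ⟨ε, hε, hεU⟩ := Metric.mem_nhds_iff.1 hU
  obtain ⟨j, hj⟩ := exists_pow_lt_of_lt_one (div_pos hε hr) hγ1
  refine ⟨j, ?_⟩
  rw [hΛ]
  refine (closedBall_subset_ball ?_).trans hεU
  calc r * γ ^ j < r * (ε / r) := mul_lt_mul_of_pos_left hj hr
    _ = ε := mul_div_cancel₀ ε hr.ne'

omit [IsUltrametricDist V] in
/-- In a proper ultrametric group the members of a ball filtration are compact. [cite: Serre1992LALG, Part II Ch. IV §9] -/
theorem isCompact_of_coe_eq_closedBall [ProperSpace V] (hΛ : ∀ j, (Λ j : Set V) = closedBall (0 : V) (r * γ ^ j)) (j : ℕ) :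
    IsCompact (Λ j : Set V) := by
  rw [hΛ]
  exact isCompact_closedBall _ _

omit [IsUltrametricDist V] in
/-- Membership in a ball filtration is a norm bound. [cite: Serre1992LALG, Part II Ch. IV §9] -/
theorem mem_iff_norm_le_of_coe_eq_closedBall (hΛ : ∀ j, (Λ j : Set V) = closedBall (0 : V) (r * γ ^ j)) {j : ℕ} {v : V} :
    v ∈ Λ j ↔ ‖v‖ ≤ r * γ ^ j := by
  rw [← SetLike.mem_coe, hΛ, mem_closedBall_zero_iff]

end Balls

/-! ## §2 Strict differentiability ⇒ the filtered Newton hypothesis on small boxes -/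

section Newton

variable {𝕜 : Type*} [NontriviallyNormedField 𝕜]
  {V : Type*} [NormedAddCommGroup V] [NormedSpace 𝕜 V] [IsUltrametricDist V]
  {W : Type*} [NormedAddCommGroup W] [NormedSpace 𝕜 W]

/-- **Identity-derivative form.**  If `ψ : V → V` has strict derivative `id` at `x₀`, then for every box size `r > 0` and ratio `γ ∈ (0,1)` there is a depth `k₀`
such that for all `k ≥ k₀`, `j ≥ k`, `‖x‖ ≤ rγᵏ`, `‖y‖ ≤ rγʲ`: `‖ψ (x₀ + (x + y)) − ψ (x₀ + x) − y‖ ≤ rγ^{j+1}`.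
[cite: Schikhof1984, §27 Lemma 27.4–Thm. 27.5] -/
theorem exists_depth_newton_of_hasStrictFDerivAt_id {ψ : V → V} {x₀ : V} (hψ : HasStrictFDerivAt ψ (ContinuousLinearMap.id 𝕜 V) x₀)
    {r γ : ℝ} (hr : 0 < r) (hγ0 : 0 < γ) (hγ1 : γ < 1) :
    ∃ k₀ : ℕ, ∀ k, k₀ ≤ k → ∀ j, k ≤ j → ∀ x ∈ closedBall (0 : V) (r * γ ^ k), ∀ y ∈ closedBall (0 : V) (r * γ ^ j),
      ψ (x₀ + (x + y)) - ψ (x₀ + x) - y ∈ closedBall (0 : V) (r * γ ^ (j + 1)) := by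
  have hO := (hψ.isLittleO).def hγ0
  obtain ⟨δ, hδ, hball⟩ := Metric.eventually_nhds_iff.1 hO
  obtain ⟨k₀, hk₀⟩ := exists_pow_lt_of_lt_one (div_pos hδ hr) hγ1
  have hk₀' : r * γ ^ k₀ < δ := by
    calc r * γ ^ k₀ < r * (δ / r) := mul_lt_mul_of_pos_left hk₀ hr
      _ = δ := mul_div_cancel₀ δ hr.ne'
  refine ⟨k₀, fun k hk j hj x hx y hy => ?_⟩
  rw [mem_closedBall_zero_iff] at hx hy ⊢
  have hγk : r * γ ^ k ≤ r * γ ^ k₀ := mul_le_mul_of_nonneg_left (pow_le_pow_of_le_one hγ0.le hγ1.le hk) hr.le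
  have hγj : r * γ ^ j ≤ r * γ ^ k := mul_le_mul_of_nonneg_left (pow_le_pow_of_le_one hγ0.le hγ1.le hj) hr.le
  have hx' : ‖x‖ < δ := lt_of_le_of_lt (hx.trans hγk) hk₀'
  have hxy : ‖x + y‖ < δ := by
    refine lt_of_le_of_lt (IsUltrametricDist.norm_add_le_max x y) (max_lt hx' ?_)
    exact lt_of_le_of_lt ((hy.trans hγj).trans hγk) hk₀'
  have hdist : dist (x₀ + (x + y), x₀ + x) (x₀, x₀) < δ := by
    rw [Prod.dist_eq, dist_eq_norm, dist_eq_norm]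
    simpa using max_lt hxy hx'
  have h := hball hdist
  simp only [ContinuousLinearMap.coe_id', id_eq, add_sub_add_left_eq_sub, add_sub_cancel_left] at h
  calc ‖ψ (x₀ + (x + y)) - ψ (x₀ + x) - y‖ ≤ γ * ‖y‖ := h
    _ ≤ γ * (r * γ ^ j) := mul_le_mul_of_nonneg_left hy hγ0.le
    _ = r * γ ^ (j + 1) := by ring

/-- **Strict differentiability ⇒ filtered Newton hypothesis with linear part `e`.**  If `φ : V → W` has strict derivative the continuous linear equivalence
`e : V ≃L[𝕜] W` at `x₀` and `V` is ultrametric, then for every `r > 0`, `γ ∈ (0,1)` there is `k₀` with: for all `k ≥ k₀`, `j ≥ k`, `x ∈ closedBall 0 (rγᵏ)`,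
`y ∈ closedBall 0 (rγʲ)`, `φ (x₀ + (x + y)) − φ (x₀ + x) − e y ∈ e '' closedBall 0 (rγ^{j+1})`. [cite: Schikhof1984, §27 Lemma 27.4–Thm. 27.5] -/
theorem exists_depth_linearNewton_of_hasStrictFDerivAt {φ : V → W} {x₀ : V} (e : V ≃L[𝕜] W) (hφ : HasStrictFDerivAt φ (e : V →L[𝕜] W) x₀)
    {r γ : ℝ} (hr : 0 < r) (hγ0 : 0 < γ) (hγ1 : γ < 1) :
    ∃ k₀ : ℕ, ∀ k, k₀ ≤ k → ∀ j, k ≤ j → ∀ x ∈ closedBall (0 : V) (r * γ ^ k), ∀ y ∈ closedBall (0 : V) (r * γ ^ j),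
      φ (x₀ + (x + y)) - φ (x₀ + x) - e y ∈ (e : V → W) '' closedBall (0 : V) (r * γ ^ (j + 1)) := by
  have hψ : HasStrictFDerivAt ((e.symm : W → V) ∘ φ) (ContinuousLinearMap.id 𝕜 V) x₀ := by
    have h := (e.symm : W ≃L[𝕜] V).hasStrictFDerivAt.comp x₀ hφ
    rwa [ContinuousLinearEquiv.coe_symm_comp_coe] at h
  obtain ⟨k₀, hk₀⟩ := exists_depth_newton_of_hasStrictFDerivAt_id hψ hr hγ0 hγ1
  refine ⟨k₀, fun k hk j hj x hx y hy => ?_⟩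
  refine ⟨(e.symm ∘ φ) (x₀ + (x + y)) - (e.symm ∘ φ) (x₀ + x) - y, hk₀ k hk j hj x hx y hy, ?_⟩
  simp [map_sub]

/-- **`AddSubgroup`-phrased form** (token shape of the filtered-Newton coset calculus): for any sequence of subgroups `Λ j` with carriers
`closedBall 0 (rγʲ)`, the translated chart `φ₀ v := φ (x₀ + v) − φ x₀` satisfies, at every depth `k ≥ k₀`,
`∀ j, k ≤ j → ∀ x ∈ Λ k, ∀ y ∈ Λ j, φ₀ (x + y) − φ₀ x − L y ∈ L '' Λ (j+1)` with `L := e.toContinuousAddEquiv`. [cite: Schikhof1984, §27 Lemma 27.4–Thm. 27.5] -/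
theorem exists_depth_linearNewton_addSubgroup {φ : V → W} {x₀ : V} (e : V ≃L[𝕜] W) (hφ : HasStrictFDerivAt φ (e : V →L[𝕜] W) x₀)
    {Λ : ℕ → AddSubgroup V} {r γ : ℝ} (hΛ : ∀ j, (Λ j : Set V) = closedBall (0 : V) (r * γ ^ j)) (hr : 0 < r) (hγ0 : 0 < γ) (hγ1 : γ < 1) :
    ∃ k₀ : ℕ, ∀ k, k₀ ≤ k → ∀ j, k ≤ j → ∀ x ∈ Λ k, ∀ y ∈ Λ j,
      (fun v => φ (x₀ + v) - φ x₀) (x + y) - (fun v => φ (x₀ + v) - φ x₀) x - e.toContinuousAddEquiv y ∈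
        (e.toContinuousAddEquiv : V → W) '' (Λ (j + 1) : Set V) := by
  obtain ⟨k₀, hk₀⟩ := exists_depth_linearNewton_of_hasStrictFDerivAt e hφ hr hγ0 hγ1
  refine ⟨k₀, fun k hk j hj x hx y hy => ?_⟩
  have hx' : x ∈ closedBall (0 : V) (r * γ ^ k) := by rw [← hΛ]; exact hx
  have hy' : y ∈ closedBall (0 : V) (r * γ ^ j) := by rw [← hΛ]; exact hy
  obtain ⟨z, hz, hzeq⟩ := hk₀ k hk j hj x hx' y hy'
  refine ⟨z, by rw [hΛ]; exact hz, ?_⟩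
  have hcoe : ∀ v, e.toContinuousAddEquiv v = e v := fun v => rfl
  simp only [hcoe, hzeq]
  abel

/-- **The chart is continuous on the box** (from strictness alone, via §0): with `Λ`, `k₀` as above and `k ≥ k₀`, `v ↦ φ (x₀ + v)` is continuous on `Λ k`.
[cite: Schikhof1984, §27 Lemma 27.4–Thm. 27.5] -/
theorem continuousOn_box_of_hasStrictFDerivAt {φ : V → W} {x₀ : V} (e : V ≃L[𝕜] W) (hφ : HasStrictFDerivAt φ (e : V →L[𝕜] W) x₀)
    {Λ : ℕ → AddSubgroup V} {r γ : ℝ} (hΛ : ∀ j, (Λ j : Set V) = closedBall (0 : V) (r * γ ^ j)) (hr : 0 < r) (hγ0 : 0 < γ) (hγ1 : γ < 1) :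
    ∃ k₀ : ℕ, ∀ k, k₀ ≤ k → ContinuousOn (fun v => φ (x₀ + v)) (Λ k : Set V) := by
  obtain ⟨k₀, hk₀⟩ := exists_depth_linearNewton_addSubgroup e hφ hΛ hr hγ0 hγ1
  refine ⟨k₀, fun k hk => ?_⟩
  have hc := continuousOn_of_linearNewton Λ (fun v => φ (x₀ + v) - φ x₀) e.toContinuousAddEquiv
    (antitone_of_coe_eq_closedBall hΛ hr.le hγ0.le hγ1.le) (isOpen_of_coe_eq_closedBall hΛ hr hγ0)
    (exists_subset_of_mem_nhds_of_coe_eq_closedBall hΛ hr hγ1) (hk₀ k hk)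
  have : (fun v => φ (x₀ + v)) = fun v => (φ (x₀ + v) - φ x₀) + φ x₀ := by ext v; abel
  rw [this]
  exact hc.add continuousOn_const

end Newton

end Literature.Analysis.Calculus
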